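import Summits.CriticalPhenomena.SAWScalingLimit.Theorems.EventualTight.Negative.EndpointLimitsFalse
import Summits.CriticalPhenomena.SAWScalingLimit.Theorems.SubseqIdentification.Negative.Necessity
import Literature.Probability.RandomPlanarGeometry.SLEConvergenceCriterion

/-!
# `EventualTight` (along the mesh, stmt-CriticalPhenomena-1881) — negative knowledge

Support file for the along-the-mesh tightness crux `EventualTight` shared (byte-identically) by the
routes `SAWTwistedSelfEnergy`, `SAWExcursionCardy`, `SAWAsymptoticMorera`, `SAWLaplacianWalk`, …
(ledger item stmt-CriticalPhenomena-1881:
`∀ D a b, SAW.IsEndpointApprox D a b → IsTightAlongMesh (fun δ γ ↦ γ.curve) (fun δ ↦ SAW.law D.carrier δ (a δ) (b δ))`);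
refuter crux-attack, 2026-08-17. Two hygiene facts about WHERE the content of the statement sits:

* `exists_isCompact_law_preimage_compl_le` / `perMesh_tightness_trivial`: for EVERY domain, mesh and
  pair of sites — no hypothesis at all — a single critical SAW law gives some compact set of curve
  classes all but `ε` of its mass (the law is `0` or a probability measure on the Polish space
  `CurveClass ℂ`, Ulam). So the `δ`-pointwise (swapped-quantifier, `∀ δ ∃ K`) reading of the crux is
  vacuous: the content is exactly ONE compact set serving all small meshes (`∃ K ∀ᶠ δ`).
* `alongMesh_false_without_endpointLimits`: the along-the-mesh statement with the endpoint limits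
  `IsEndpointApprox.tendsto_fst/snd` dropped (only `reachable` kept) is FALSE (unit disc, coincident
  far endpoints `a δ = b δ = (⌈δ⁻²⌉₊, 0)`: Dirac masses at constant curves of norm `≥ δ⁻¹` escape every
  compact set along `δ → 0⁺`). This is the along-the-mesh counterpart of the landed set-form lemma
  `eventualTight_false_without_endpointLimits` and is formally STRONGER
  (`setFormWithout_imp_alongMeshWithout`: the set form implies the along-the-mesh form pointwise in
  `(D, a, b)`), so any proof of stmt-1881 must use the endpoint limits. Everything proved, standard
  axioms. [folklore]
-/

noncomputable section

open MeasureTheory Filter Topology Set Metric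
open Literature.Probability.RandomPlanarGeometry Literature.Probability.RandomPlanarGeometry.SAW
  Literature.Probability.LatticeModels
open scoped ENNReal

namespace Summit.CriticalPhenomena.SAWScalingLimit.Theorems.EventualTight.Negative

open Summit.CriticalPhenomena.SAWScalingLimit.Theorems.SubseqIdentification.Negative
  (law_self curve_nil isProbabilityMeasure_law_or_eq_zero)

/-! ### Per-mesh tightness is free (quantifier order is the content) -/

/-- For every `Ω`, `δ`, `a`, `b` and `ε > 0` some compact set of curve classes carries all but `ε`
of the critical SAW law (which is `0` or a probability measure on the Polish space `CurveClass ℂ`).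
[folklore] -/
theorem exists_isCompact_law_preimage_compl_le (Ω : Set ℂ) (δ : ℝ) (a b : Site 2) {ε : ℝ≥0∞}
    (hε : 0 < ε) :
    ∃ K : Set (CurveClass ℂ), IsCompact K ∧
      law Ω δ a b ((fun γ : DomainSAW Ω δ a b => γ.curve) ⁻¹' Kᶜ) ≤ ε := by
  rcases isProbabilityMeasure_law_or_eq_zero Ω δ a b with h | h
  · haveI := h
    obtain ⟨K, hK, hb⟩ := (isTightMeasureSet_iff_exists_isCompact_measure_compl_le.1
      (isTightMeasureSet_singleton (μ := (law Ω δ a b).map (fun γ => γ.curve)))) ε hε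
    refine ⟨K, hK, ?_⟩
    have h1 := hb _ rfl
    rwa [Measure.map_apply (DomainSAW.measurable_of_top _) hK.isClosed.measurableSet.compl] at h1
  · exact ⟨∅, isCompact_empty, by rw [h]; simp⟩

/-- Hence the swapped-quantifier (`∀ δ ∃ K`) reading of the along-the-mesh crux holds for EVERY
domain and EVERY pair of endpoint maps, with no hypothesis: it is not the crux. [folklore] -/
theorem perMesh_tightness_trivial (Ω : Set ℂ) (a b : ℝ → Site 2) :
    ∀ ε : ℝ≥0∞, 0 < ε → ∀ δ : ℝ, ∃ K : Set (CurveClass ℂ), IsCompact K ∧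
      law Ω δ (a δ) (b δ) ((fun γ : DomainSAW Ω δ (a δ) (b δ) => γ.curve) ⁻¹' Kᶜ) ≤ ε :=
  fun _ hε δ => exists_isCompact_law_preimage_compl_le Ω δ (a δ) (b δ) hε

/-! ### The endpoint limits are load-bearing for the along-the-mesh form -/

/-- The set form (`∃ δ₀`, stmt-1372 shape) without endpoint limits implies the along-the-mesh form
(stmt-1881 shape) without endpoint limits, pointwise in `(D, a, b)`. [folklore] -/
theorem setFormWithout_imp_alongMeshWithout (D : DobrushinDomain) (a b : ℝ → Site 2)
    (h : ∃ δ₀ : ℝ, 0 < δ₀ ∧ IsTightMeasureSet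
      ((fun δ => (law D.carrier δ (a δ) (b δ)).map (fun γ => γ.curve)) '' Set.Ioc 0 δ₀)) :
    IsTightAlongMesh (fun δ (γ : DomainSAW D.carrier δ (a δ) (b δ)) => γ.curve)
      (fun δ => law D.carrier δ (a δ) (b δ)) := by
  obtain ⟨δ₀, hδ₀, hT⟩ := h
  exact isTightAlongMesh_of_isTightMeasureSet_image
    (Eventually.of_forall fun δ => aemeasurable_curve D.carrier δ (a δ) (b δ)) hδ₀ hT

/-- **The endpoint limits are load-bearing for the along-the-mesh crux (stmt-1881)**: with
`tendsto_fst` / `tendsto_snd` dropped from `IsEndpointApprox` (only `reachable` kept) the statement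
is FALSE. Witness: the unit disc, `a δ = b δ = (⌈δ⁻²⌉₊, 0)` (joined by the trivial walk), whose law
is the Dirac mass at the constant curve at distance `≥ δ⁻¹` from the origin: for any compact `K` the
mass of `Kᶜ` is `1 > 1/2` at meshes arbitrarily close to `0`. [folklore] -/
theorem alongMesh_false_without_endpointLimits :
    ¬ (∀ (D : DobrushinDomain) (a b : ℝ → Site 2),
        (∀ᶠ δ in 𝓝[>] (0 : ℝ), (discreteDomainGraph D.carrier δ).Reachable (a δ) (b δ)) →
        IsTightAlongMesh (fun δ (γ : DomainSAW D.carrier δ (a δ) (b δ)) => γ.curve)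
          (fun δ => law D.carrier δ (a δ) (b δ))) := by
  intro h
  have hT := h DobrushinDomain.unitDisc (fun δ => ![((⌈δ⁻¹ ^ 2⌉₊ : ℕ) : ℤ), 0])
    (fun δ => ![((⌈δ⁻¹ ^ 2⌉₊ : ℕ) : ℤ), 0]) (Eventually.of_forall fun δ => SimpleGraph.Reachable.refl _)
  obtain ⟨K, hK, hev⟩ := hT 2⁻¹ (by simp)
  obtain ⟨R, hR0, hR⟩ := exists_bound_source_of_isCompact hK
  obtain ⟨δ₁, hδ₁, hsub⟩ := mem_nhdsGT_iff_exists_Ioo_subset.1 hev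
  have hδ₁pos : (0 : ℝ) < δ₁ := hδ₁
  -- a mesh in `(0, δ₁)` with `δ⁻¹ > R`
  set δ : ℝ := min (δ₁ / 2) (1 / (R + 1)) with hδ_def
  have hδpos : 0 < δ := lt_min (half_pos hδ₁pos) (by positivity)
  have hδlt : δ < δ₁ := (min_le_left _ _).trans_lt (half_lt_self hδ₁pos)
  have hδR : R < δ⁻¹ := by
    have h1 : δ ≤ 1 / (R + 1) := min_le_right _ _
    have h2 : R + 1 ≤ δ⁻¹ := (le_inv_comm₀ (by positivity) hδpos).2 (by simpa [one_div] using h1)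
    linarith
  have hle : law DobrushinDomain.unitDisc.carrier δ ![((⌈δ⁻¹ ^ 2⌉₊ : ℕ) : ℤ), 0]
      ![((⌈δ⁻¹ ^ 2⌉₊ : ℕ) : ℤ), 0]
      ((fun γ : DomainSAW DobrushinDomain.unitDisc.carrier δ ![((⌈δ⁻¹ ^ 2⌉₊ : ℕ) : ℤ), 0]
        ![((⌈δ⁻¹ ^ 2⌉₊ : ℕ) : ℤ), 0] => γ.curve) ⁻¹' Kᶜ) ≤ 2⁻¹ := hsub ⟨hδpos, hδlt⟩
  have hnot : CurveClass.mk (Curve.const (meshPoint δ ![((⌈δ⁻¹ ^ 2⌉₊ : ℕ) : ℤ), 0])) ∉ K :=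
    fun hin => by
      have h1 := hR _ hin
      simp only [CurveClass.source_mk, Curve.source_def, Curve.const_apply] at h1
      linarith [inv_le_norm_meshPoint_far hδpos]
  have hmem : (DomainSAW.nil ![((⌈δ⁻¹ ^ 2⌉₊ : ℕ) : ℤ), 0] :
      DomainSAW DobrushinDomain.unitDisc.carrier δ _ _) ∈
      (fun γ : DomainSAW DobrushinDomain.unitDisc.carrier δ ![((⌈δ⁻¹ ^ 2⌉₊ : ℕ) : ℤ), 0]
        ![((⌈δ⁻¹ ^ 2⌉₊ : ℕ) : ℤ), 0] => γ.curve) ⁻¹' Kᶜ := by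
    rw [Set.mem_preimage, Set.mem_compl_iff, curve_nil]
    exact hnot
  rw [law_self, Measure.dirac_apply_of_mem hmem] at hle
  exact absurd hle (by norm_num)

/-- The landed set-form lemma `eventualTight_false_without_endpointLimits` is a COROLLARY of the
along-the-mesh one (recorded to fix the direction of strength). [folklore] -/
example : ¬ (∀ (D : DobrushinDomain) (a b : ℝ → Site 2),
    (∀ᶠ δ in 𝓝[>] (0 : ℝ), (discreteDomainGraph D.carrier δ).Reachable (a δ) (b δ)) →
    ∃ δ₀ : ℝ, 0 < δ₀ ∧ IsTightMeasureSet
      ((fun δ => (law D.carrier δ (a δ) (b δ)).map (fun γ => γ.curve)) '' Set.Ioc 0 δ₀)) :=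
  fun h => alongMesh_false_without_endpointLimits fun D a b hr =>
    setFormWithout_imp_alongMeshWithout D a b (h D a b hr)

end Summit.CriticalPhenomena.SAWScalingLimit.Theorems.EventualTight.Negative

end
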